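import Summits.QuantumFields.BalabanUV.T4Continuum.Support.NE7RoadBLettersFlatWitness
import HarnessLib

/-!
# NE7SliceLetterHomFlatWitness — THE REPAIRED LETTER (L2)ʰ IN AFFORDABLE CURRENCY AT THE FLAT BACKGROUND: for `d ≥ 2`, `L ≥ 2` there is `K ≥ 0` (free of `N`, `j`) such that at
# `W = flatCfg` the homogeneous two-term slice-solver letter of the live END (`…RoadBGradientClassH`) holds on `S = {skew fields}` with `(K_G, K_X) = (K·L^{j+1}, 0)` — the flat
# one-term theorem (152) (lineage #2) read in the new shape; so the new END's letter is inhabited in the ASSEMBLER's currency at flat data and (F136) inhabited with trivial constants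
# everywhere (file 68 of the curved (APE))

Cell `pub-balaban`, rung (B)+1 sub-cell t4, lineage `b2b-balaban-t4-ne7-p1` (CRUX PROVER NE7 #1 = OWNER of row NE7), generation 80; memo
`t4/b2b-balaban-t4-ne7-p1-g80/SLICE-LETTER-OBSTRUCTION.md` §7.  File F138, over F124 `NE7RoadBLettersFlatWitness.sliceSolver_letter_flatCfg` ((152) in road (B)'s shape).
WHAT ([folklore]; 0 def, 0 sorry).  **`homSliceLetter_flatCfg`**.
HONEST FRAMING (page 1): shape bookkeeping over a landed theorem; nothing new at curved data; nothing of Bałaban's asserted beyond what (152) cites; NOT ONE-STEP, NOT NE7; spine 0∕9;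
finite T⁴ rung (B)+1 — NOT infinite volume, NOT mass gap, NOT `BetaPertH`, NOT Clay.  Continuum YM on T⁴ ⇐ BetaPertH ∧ nine spine estimates (0/9 proved); BetaPertH ⇐ (D1) ∧ (D4) ∧
CAP+tail; G-an2-4 gates asym, D1 and NE2/3/4.
-/

set_option autoImplicit false

open scoped BigOperators Matrix Matrix.Norms.L2Operator
open NormedSpace Finset

namespace Summit.QuantumFields.BalabanUV.T4Continuum.NE7SliceLetterHomFlatWitness

open Literature.MathematicalPhysics.QuantumFieldTheory.Balaban1983to89
open B7Prop1Explicit B7Prop2Explicit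
open T4AveragingDeficitWall (IsSkewDir curlAt dirL1)
open T4AveragingDeficitWallBoundary (periodBox)
open AveragingDeficitPeriodicCounting (IsPeriodicDir)
open MinimalActionLevels (perWin)
open MinimalActionWitness (flatCfg)
open NE3HessForm (hess)
open NE3TangentCovariantTower (dirIter)
open NE7RoadBLettersFlatWitness (sliceSolver_letter_flatCfg)

noncomputable section

variable {d : ℕ} {n : Type} [Fintype n] [DecidableEq n]

/-- **(L2)ʰ AT THE FLAT BACKGROUND WITH `(K_G, K_X) = (K·L^{j+1}, 0)`**: for `d ≥ 2`, `L ≥ 2` there is `K ≥ 0` (free of `N`, `j`) such that for every `N ≥ 1`, `j`, with `S = {skew fields}`,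
the homogeneous two-term letter holds at `W = flatCfg` (the sup hypothesis is not used: the flat letter is one-term). [folklore] -/
theorem homSliceLetter_flatCfg [Nonempty n] (hd : 2 ≤ d) {L : ℕ} (hL : 2 ≤ L) :
    ∃ K : ℝ, 0 ≤ K ∧ ∀ (N : ℕ) [NeZero N] (j : ℕ),
      ∀ X ∈ {X : Site d → Fin d → Matrix n n ℂ | IsSkewDir X}, IsPeriodicDir X ((N * L ^ (j + 1) : ℕ) : ℤ) →
        dirIter L (j + 1) (flatCfg : Site d → Fin d → (Matrix n n ℂ)ˣ) X = 0 → ∀ R : ℝ, (∀ y κ', ‖X y κ'‖ ≤ R) → ∀ g : ℝ, 0 ≤ g →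
        (∀ Y : Site d → Fin d → Matrix n n ℂ, IsSkewDir Y → IsPeriodicDir Y ((N * L ^ (j + 1) : ℕ) : ℤ) →
          dirIter L (j + 1) (flatCfg : Site d → Fin d → (Matrix n n ℂ)ˣ) Y = 0 →
          |hess (flatCfg : Site d → Fin d → (Matrix n n ℂ)ˣ) X Y (perWin d (N * L ^ (j + 1)))| ≤ g * dirL1 Y (periodBox (d := d) (N * L ^ (j + 1)))) →
        ∀ (z : Site d) (μ' ν' : Fin d), μ' ≠ ν' →
          ‖curlAt (flatCfg : Site d → Fin d → (Matrix n n ℂ)ˣ) X z μ' ν'‖ ≤ (K * (L : ℝ) ^ (j + 1)) * g + 0 * R := by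
  obtain ⟨K, hK, h⟩ := sliceSolver_letter_flatCfg (n := n) hd hL
  refine ⟨K, hK, fun N _ j X hX hXP hX0 R _ g hg hH z μ' ν' hne => ?_⟩
  rw [zero_mul, add_zero]
  exact h N j X hX hXP hX0 g hg hH z μ' ν' hne

end

end Summit.QuantumFields.BalabanUV.T4Continuum.NE7SliceLetterHomFlatWitness
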